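import Summits.PneNP.PneNP.Theorems.KarlinRubinMonotoneBlindFormDefs

/-!
# Route KarlinRubin, crux `MonotoneBlind` (stmt-PneNP-18027): constant depth — definitions for the depth reduction

Stage C of the AC⁰ line (seat write-up `MonotoneBlind_AC0_announce.md`), the objects of the iteration built on the
layered formulas `swForm` of `…FormDefs`:

* `swForm.clauses` — a level-`1` formula as its clause list (plus the clause-form unfolding lemmas);
* `swBadAt V₁ x v₀ d pol f` — the bad event of the restriction `(V₁, x)`: some depth-2 sub-formula of `f` has a
  canonical run meeting `≥ v₀` vertices;
* `swErase V₁ x`, `swGlue V₁ x ξ` — the outside part of an input / gluing an inside and an outside part;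
* `swSizeOK`, `swT`, `swErr` — admissible universe sizes, the bound of the switching lemma, and the accumulated error
  of the depth reduction; `swLast`, `swRatioOK` — the last size and the shrinking condition `m_{i+1}^{v₀} n^E ≤ m_i^{v₀}`;
* `swSize n η i = ⌈n^{1 - i η}⌉`, `swSizes n η i d = [swSize (i+1), …, swSize (i+d)]` — the sizes used in the end.

All `--supports stmt-PneNP-18027`.
-/

set_option linter.dupNamespace false -- `Summit.PneNP.PneNP.…`: summit = sub-problem (D-0017)

namespace Summit.PneNP.PneNP.Theorems

open Finset
open scoped ENNReal
open Literature.Computability.Complexity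
open Literature.Probability.RandomGraphs.PlantedClique

variable {n : ℕ}

/-! ### Level-`1` formulas as clause lists -/

/-- A level-`1` formula (a CNF or a DNF) as its list of slot sets (the declared type makes the identification
`swForm n 0 = Finset _` invisible to tactics). [folklore] -/
abbrev swForm.clauses (f : swForm n 1) : List (Finset (⊤ : SimpleGraph (Fin n)).edgeSet) := f

/-- Unfolding `swLeaves` at level `0`, clause form. [folklore] -/
theorem swLeaves_zero' (pol : Bool) (l : swForm n 1) : swLeaves 0 pol l = [(pol, l.clauses)] := rfl

/-- Unfolding `swReduce` at level `0`, polarity OR, clause form. [folklore] -/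
theorem swReduce_zero_true' (V₁ : Finset (Fin n)) (x : EdgeVec n) (l : swForm n 2) :
    swReduce V₁ x 0 true l = swForm.node (l.kids.flatMap fun c => ((swDnf V₁ x c.clauses).toList.map swForm.leaf)) :=
  rfl

/-- Unfolding `swReduce` at level `0`, polarity AND, clause form. [folklore] -/
theorem swReduce_zero_false' (V₁ : Finset (Fin n)) (x : EdgeVec n) (l : swForm n 2) :
    swReduce V₁ x 0 false l =
      swForm.node (l.kids.flatMap fun c => ((swDnf V₁ (fun e => !x e) c.clauses).toList.map swForm.leaf)) := rfl

/-- Unfolding `swIn` at level `1`, clause form. [folklore] -/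
theorem swIn_one (V : Finset (Fin n)) (c : swForm n 1) :
    swIn V 1 c ↔ ∀ S ∈ c.clauses, ∀ e ∈ S, ∀ v ∈ (e : Sym2 (Fin n)), v ∈ V := Iff.rfl

/-- Unfolding `swBnd` at level `1`, clause form. [folklore] -/
theorem swBnd_one (M L : ℕ) (c : swForm n 1) :
    swBnd M L 1 c ↔ c.clauses.length ≤ M ∧ ∀ S ∈ c.clauses, S.card ≤ L := Iff.rfl


/-! ### The bad event of a restriction -/

open Classical in
/-- **The bad event** of the restriction `(V₁, x)` for a level-`(d+1)` formula: some depth-2 sub-formula has a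
canonical run (on `x` for the CNF ones, on `¬x` for the DNF ones) whose queried slots meet `≥ v₀` vertices.
[cite: Beame1994, §3] -/
def swBadAt (V₁ : Finset (Fin n)) (x : EdgeVec n) (v₀ d : ℕ) (pol : Bool) (f : swForm n (d + 1)) : Prop :=
  ∃ p ∈ swLeaves d pol f, ∃ z : EdgeVec n, v₀ ≤ #(univ.filter fun v : Fin n =>
    ∃ e ∈ (swRun V₁ (if p.1 then (fun e => !x e) else x) z p.2 ∅).2, v ∈ (e : Sym2 (Fin n)))

open Classical in
/-- Off the bad event every run of every depth-2 sub-formula meets `< v₀` vertices. [folklore] -/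
theorem good_of_not_swBadAt {V₁ : Finset (Fin n)} {x : EdgeVec n} {v₀ d : ℕ} {pol : Bool} {f : swForm n (d + 1)}
    (h : ¬ swBadAt V₁ x v₀ d pol f) :
    ∀ p ∈ swLeaves d pol f, ∀ z : EdgeVec n, #(univ.filter fun v : Fin n =>
      ∃ e ∈ (swRun V₁ (if p.1 then (fun e => !x e) else x) z p.2 ∅).2, v ∈ (e : Sym2 (Fin n))) < v₀ := by
  intro p hp z
  by_contra hge
  exact h ⟨p, hp, z, not_lt.1 hge⟩


/-! ### Erasing and gluing along the inside of a vertex set -/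

open Classical in
/-- Whiten the slots inside `V₁` (the "outside part" of an input). [folklore] -/
noncomputable def swErase (V₁ : Finset (Fin n)) (x : EdgeVec n) : EdgeVec n :=
  fun e => if (∀ v ∈ (e : Sym2 (Fin n)), v ∈ V₁) then false else x e

open Classical in
/-- The input that is `x` inside `V₁` and `ξ` elsewhere. [folklore] -/
noncomputable def swGlue (V₁ : Finset (Fin n)) (x ξ : EdgeVec n) : EdgeVec n :=
  fun e => if (∀ v ∈ (e : Sym2 (Fin n)), v ∈ V₁) then x e else ξ e

/-- `swErase` is white inside. [folklore] -/
theorem swErase_of_inside (V₁ : Finset (Fin n)) (x : EdgeVec n) {e : (⊤ : SimpleGraph (Fin n)).edgeSet}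
    (he : ∀ v ∈ (e : Sym2 (Fin n)), v ∈ V₁) : swErase V₁ x e = false := by
  classical
  simp only [swErase, if_pos he]

/-- `swErase` is `x` outside. [folklore] -/
theorem swErase_of_not_inside (V₁ : Finset (Fin n)) (x : EdgeVec n) {e : (⊤ : SimpleGraph (Fin n)).edgeSet}
    (he : ¬ ∀ v ∈ (e : Sym2 (Fin n)), v ∈ V₁) : swErase V₁ x e = x e := by
  classical
  simp only [swErase, if_neg he]

/-- `swGlue` is `x` inside. [folklore] -/
theorem swGlue_of_inside (V₁ : Finset (Fin n)) (x ξ : EdgeVec n) {e : (⊤ : SimpleGraph (Fin n)).edgeSet}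
    (he : ∀ v ∈ (e : Sym2 (Fin n)), v ∈ V₁) : swGlue V₁ x ξ e = x e := by
  classical
  simp only [swGlue, if_pos he]

/-- `swGlue` is `ξ` outside. [folklore] -/
theorem swGlue_of_not_inside (V₁ : Finset (Fin n)) (x ξ : EdgeVec n) {e : (⊤ : SimpleGraph (Fin n)).edgeSet}
    (he : ¬ ∀ v ∈ (e : Sym2 (Fin n)), v ∈ V₁) : swGlue V₁ x ξ e = ξ e := by
  classical
  simp only [swGlue, if_neg he]

/-- Erased inputs are exactly the inputs white inside. [folklore] -/
theorem swErase_eq_self_iff (V₁ : Finset (Fin n)) (ξ : EdgeVec n) :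
    swErase V₁ ξ = ξ ↔ ∀ e : (⊤ : SimpleGraph (Fin n)).edgeSet, (∀ v ∈ (e : Sym2 (Fin n)), v ∈ V₁) → ξ e = false := by
  constructor
  · intro h e he
    rw [← h]
    exact swErase_of_inside V₁ ξ he
  · intro h
    funext e
    by_cases he : ∀ v ∈ (e : Sym2 (Fin n)), v ∈ V₁
    · rw [swErase_of_inside V₁ ξ he, h e he]
    · rw [swErase_of_not_inside V₁ ξ he]

/-- Erasing the glued input recovers the (white-inside) outside part. [folklore] -/
theorem swErase_swGlue (V₁ : Finset (Fin n)) (x ξ : EdgeVec n)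
    (hξ : ∀ e : (⊤ : SimpleGraph (Fin n)).edgeSet, (∀ v ∈ (e : Sym2 (Fin n)), v ∈ V₁) → ξ e = false) :
    swErase V₁ (swGlue V₁ x ξ) = ξ := by
  funext e
  by_cases he : ∀ v ∈ (e : Sym2 (Fin n)), v ∈ V₁
  · rw [swErase_of_inside V₁ _ he, hξ e he]
  · rw [swErase_of_not_inside V₁ _ he, swGlue_of_not_inside V₁ x ξ he]


/-! ### The sizes and the error -/

/-- Admissible sizes: `m ≥ m₁ ≥ ⋯ ≥ m_j`, each `≥ v₀`, and `2 ≤ k ≤ m_j`. [folklore] -/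
def swSizeOK (v₀ k : ℕ) : ℕ → List ℕ → Prop
  | m, [] => 2 ≤ k ∧ k ≤ m
  | m, m₁ :: ms => v₀ ≤ m₁ ∧ m₁ ≤ m ∧ swSizeOK v₀ k m₁ ms

/-- The bound of the switching lemma for `M` CNFs with clauses of `≤ L` slots and vertex cutoff `v₀` (`r = C(v₀-1,2)`):
`T(M,L) = 2^{2r} (2(L+1)^{2r})^{r+1} + M·C(2L, v₀)`. [cite: Beame1994, §3] -/
def swT (v₀ M L : ℕ) : ℕ :=
  2 ^ ((v₀ - 1).choose 2 + (v₀ - 1).choose 2) * (2 * (L + 1) ^ (2 * (v₀ - 1).choose 2)) ^ ((v₀ - 1).choose 2 + 1) +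
    M * (2 * L).choose v₀

/-- `swT` is monotone in `(M, L)`. [folklore] -/
theorem swT_mono (v₀ : ℕ) {M M' L L' : ℕ} (hM : M ≤ M') (hL : L ≤ L') : swT v₀ M L ≤ swT v₀ M' L' := by
  unfold swT
  gcongr

/-- The error of the depth reduction along the sizes `ms = [m₁, …, m_d]` (see `swIter_count_le`):
`swErr m [] M L = L k²/m²`, `swErr m (m₁ :: ms) M L = M^{|ms|+1} T(M,L) m₁^{v₀}/m^{v₀} + swErr m₁ ms (M 2^r) r`. [folklore] -/
noncomputable def swErr (v₀ k : ℕ) : ℕ → List ℕ → ℕ → ℕ → ℝ≥0∞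
  | m, [], _, L => ((L * k ^ 2 : ℕ) : ℝ≥0∞) / ((m ^ 2 : ℕ) : ℝ≥0∞)
  | m, m₁ :: ms, M, L =>
      ((M ^ (ms.length + 1) * swT v₀ M L * m₁ ^ v₀ : ℕ) : ℝ≥0∞) / ((m ^ v₀ : ℕ) : ℝ≥0∞) +
        swErr v₀ k m₁ ms (M * 2 ^ (v₀ - 1).choose 2) ((v₀ - 1).choose 2)

/-- Admissible sizes dominate the clique size. [folklore] -/
theorem k_le_of_swSizeOK (v₀ k : ℕ) : ∀ (ms : List ℕ) (m : ℕ), swSizeOK v₀ k m ms → 2 ≤ k ∧ k ≤ m := by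
  intro ms
  induction ms with
  | nil => intro m h; exact h
  | cons m₁ ms ih =>
    intro m h
    obtain ⟨-, hm₁, h⟩ := h
    exact ⟨(ih m₁ h).1, (ih m₁ h).2.trans hm₁⟩

/-- The last size. [folklore] -/
def swLast : ℕ → List ℕ → ℕ
  | m, [] => m
  | _, m₁ :: ms => swLast m₁ ms

/-- The shrinking condition along the sizes: `m_{i+1}^{v₀} · n^E ≤ m_i^{v₀}`. [folklore] -/
def swRatioOK (v₀ E n : ℕ) : ℕ → List ℕ → Prop
  | _, [] => True
  | m, m₁ :: ms => m₁ ^ v₀ * n ^ E ≤ m ^ v₀ ∧ swRatioOK v₀ E n m₁ ms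

/-- The `i`-th universe size `⌈n^{1 - i η}⌉`. [folklore] -/
noncomputable def swSize (n : ℕ) (η : ℝ) (i : ℕ) : ℕ := ⌈(n : ℝ) ^ (1 - i * η)⌉₊

/-- The sizes `[swSize (i+1), …, swSize (i+d)]`. [folklore] -/
noncomputable def swSizes (n : ℕ) (η : ℝ) : ℕ → ℕ → List ℕ
  | _, 0 => []
  | i, d + 1 => swSize n η (i + 1) :: swSizes n η (i + 1) d

/-- `swSizes` has the prescribed length. [folklore] -/
theorem length_swSizes (n : ℕ) (η : ℝ) : ∀ (d i : ℕ), (swSizes n η i d).length = d := by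
  intro d
  induction d with
  | zero => intro i; rfl
  | succ d ih => intro i; simp only [swSizes, List.length_cons, ih]

/-- The last of the sizes. [folklore] -/
theorem swLast_swSizes (n : ℕ) (η : ℝ) : ∀ (d i : ℕ), swLast (swSize n η i) (swSizes n η i d) = swSize n η (i + d) := by
  intro d
  induction d with
  | zero => intro i; rfl
  | succ d ih => intro i; simp only [swSizes, swLast, ih, Nat.add_right_comm i 1 d, Nat.add_assoc]

/-- The top size is `n`. [folklore] -/
theorem swSize_zero (n : ℕ) (η : ℝ) : swSize n η 0 = n := by
  simp [swSize]

/-- Registered stub `stub_formIterDefs` of the AC⁰ line, stage C (the top size is `n`). [folklore] -/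
theorem stub_formIterDefs : ∀ (n : ℕ) (η : ℝ), ⌈((n : ℝ)) ^ (1 - ((0 : ℕ) : ℝ) * η)⌉₊ = n :=
  fun n η => swSize_zero n η

end Summit.PneNP.PneNP.Theorems
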